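import Summits.QuantumFields.YangMills.Theorems.FluctuationComparisonRegPrIntLS2BetaCellMaximalSquareFunction
import Mathlib.Algebra.Order.Chebyshev
import Mathlib.Algebra.Order.BigOperators.Ring.Finset
import HarnessLib

/-!
# S2β · (SCT′-c)₁ K-UNIFORMITY — «THE COMPOSED-KERNEL DOCK» (lattice-free): TRUE-KERNEL PROPAGATION ∘ (★) ⟹ a weighted sum over generations of read-set MAXIMA of squared
# kernel-propagated masses is bounded by the finest energy `Σ ρ²`, with a constant that does NOT see the number of generations

Cell `ym3-torus` (YM ladder rung R3 = continuum `SU(2)` Yang–Mills on the three-torus at fixed lattice data — a RUNG: NOT d = 4, NOT infinite volume, NOT a mass gap,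
NOT Clay).  Width seat «width 16» `ym3-torus-px16` (gen 23), S2β pairing-letter lane holder by lineage; crux `stmt-QuantumFields-20520`
(`…Theses.UnitScaleTilt.FluctuationComparisonRegPrIntL`), LINE g18-1 S2β.  `--kind proof --supports stmt-QuantumFields-20520 --as helper`, count-neutral, DEFINITION-FREE
(0 `def`, 0 `instance`, 0 `notation`, 0 `sorry`, default heartbeats).  Mathlib-only finite-sum algebra over ✓p830704 (★) `…CellMaximalSquareFunction` BY NAME; sibling of
✓p829914 (W2) `…WeightedTwoProfileTowerSum`.

WHY (px16 g22 17:49:04Z LOCATE (i) «propagate with the TRUE kernel, do not collapse to a per-level sup»; px13 g26 (CURL-AVG) A–F ✓p829604…✓p830710: per RG step the linearised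
relative curls are transported by DILUTED Stokes with an explicit kernel — `Σ_q W = L²`, `max_q W ≤ L^{2−d}`, column sums `≤ L^{2−d}`, support ⊂ four corner blocks; px17 g22
✓p830683 `supTower_of_liftLadder₃`'s hypothesis `hSCT₁`).  Composing the one-step kernels gives, `n` levels below a coarse plaquette, a kernel `K_n` with `max K_n ≤ L^{(2−d)n}` supported
in O(1) L-adic CELLS of generation `n`; then `(K_n ρ)(y) ≤ L^{(2−d)n}·Σ_{cells c near y} S(c)` (`S(c)` = the `ℓ¹` mass of the finest data on `c`), and with the (ST) weights `L^{k−1−n}`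
the combination `L^{k−1−n}·L^{2(2−d)n}·|c|` is FLAT in `n` exactly at `d = 3` (`|c| = L^{3n}`): every generation's term is `≲ L^{k−1}·Σ_B max_{c ⊂ read(B)} S(c)²∕|c|`, and (★)
✓`cellMax_invariant` sums the generations K-UNIFORMLY.  THIS FILE is that bookkeeping, abstracted: no lattice, no `T3Family`; the T³ instantiation (X = level-K plaquettes of one
orientation, `cl n` = same `blockIter n` of the base site, `b = L³`, `K_n` = CURL-AVG's kernel composed, READ′ cells) is the c₁ KNIT, not here.

DATA (lattice-free).  A finite type `X` (finest plaquettes); class maps `cl : ℕ → X → Finset X` with (★)'s four hypotheses (`x ∈ cl n x`; `y ∈ cl n x → cl n y = cl n x`;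
`cl n x ⊆ cl (n+1) x`; `#(cl n x) ≤ b^n`, `b ≥ 4`); data `ρ : X → ℝ`; a top generation `m`; an index type `ι` of «top bonds» with read sets `read n i : Finset X` (representatives of the
generation-`n` coarse plaquettes read at bond `i`); kernels `K n : X → X → ℝ` («composed kernel from the gen-`n` coarse plaquette represented by `y` to the finest plaquette `q`») with
`0 ≤ K n y q ≤ μ n` and `K n y q ≠ 0 → q ∈ cl n r` for some `r` in a support family `nb n y` of `≤ κ` representatives; per-bond families `top i ⊆ R` of gen-`m` representatives containing
every support representative read at `i` (`R` with pairwise-disjoint gen-`m` classes, each `r ∈ R` charged to `≤ ν` bonds); weights `Λ n ≥ 0` with the FLATNESS `Λ n·(μ n)²·b^n ≤ Λ★`.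
Write `S_n(r) := Σ_{z ∈ cl n r} ρ z`.

WHAT IS PROVED (sorry-free).
§1 TWO-KERNEL COMPOSITION ALGEBRA on finite types (the per-step letters the knit iterates; heterogeneous types `X → Y → Z`): ★`comp_nonneg`, ★`comp_le_max_mul_colsum`
   (`Σ_z W p z·W′ z q ≤ (max W)·(colsum W′)`), ★`colsum_comp_le` (`Σ_p Σ_z W p z·W′ z q ≤ (colsum W)·(colsum W′)`), ★`rowsum_comp_le`, ★`comp_support` — so from CURL-AVG F's
   one-step `max ≤ L^{2−d}`, `colsum ≤ L^{2−d}` the composed kernel has `max K_n ≤ L^{(2−d)n}` by induction in the knit.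
§2 ★★`kernel_le_mass` — THE CELL-MASS DOMINATION: `Σ_q K n y q·ρ q ≤ μ n·Σ_{r ∈ nb n y} S_n(r)` for `ρ ≥ 0`.
§3 ★★★`dock_of_cellMass` — THE DOCK, cell-mass form: if `0 ≤ P n y ≤ μ n·Σ_{r ∈ nb n y} S_n(r)` at every read representative, then for EVERY selection `sel n i ∈ read n i`
      `Σ_{n ≤ m} Λ n·Σ_i P n (sel n i)² ≤ Λ★·κ²·ν·(2(b−1)∕(b−3))·Σ_z ρ z²`
   (Chebyshev over the `κ` support cells; each support cell sits in a top class of `top i`, where (★) `cellMax_invariant` sums the generations; multiplicity `ν`; disjointness of `R`).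
   A bound uniform over selections IS the bound for the read-set maxima; ★★`dock_of_cellMass_sup'` restates it with `Finset.sup'` for nonempty read sets.
§4 ★★★`dock_of_kernel` ∕ ★★`dock_of_kernel_sup'` — the kernel form (`P n y := Σ_q K n y q·ρ q`, `ρ ≥ 0`) by §2 ∘ §3: the K-UNIFORM curl-driven part of (SCT′-c)₁.
WHAT IS NOT HERE: the θ-suppressed chord→curl sources `O(δ, α, α_p)·M` and the quadratic `O(ℓ²)·M²` of CURL-AVG C (they carry `Σ_q W = L²` per step — smooth-type — and belong to
the (M, V) profile recursion, px16 g22 17:49:04Z (iii)); the T³ instantiation; any letter of LIFT-LADDER′.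

HONEST SCOPE.  Finite-sum algebra; nothing of Bałaban's analysis is asserted or proved ([Balaban1985Averaging] (19)–(20) p.21, Prop. 1 ∕ Prop. 4 (128)–(135) pp.37–38: the printed
one-step averaging of plaquette variables and the sup recursion this bookkeeping serves); (SCT′-c)₁₂₃, (LIFT-LAD′), (TOP-LAD′), (ST′), (ST), LOC, AVG₂♭-ax_q, (D-ax), h3 HYPOTHESES;
GAP♯∘ (`stub_uniformFibreGapOrbit`, registry untouched, 0∕5), S2β, crux 20520, 19936, 19200 and `YM3TorusSU2` are NOT proved; no registered stub is closed; rung R3 = SU(2) YM₃ on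
T³ — NOT d = 4, NOT infinite volume, NOT a mass gap, NOT Clay; the Yang–Mills mass gap is NOT proved.
References: T. Bałaban, CMP **98** (1985) 17–51 [Balaban1985Averaging]; CMP **109** (1987) 249–301 [Balaban1987RG1].
-/

set_option autoImplicit false

namespace Summit.QuantumFields.YangMills.Theorems.FluctuationComparisonRegPrIntLS2BetaComposedKernelDock

open Finset
open Summit.QuantumFields.YangMills.Theorems.FluctuationComparisonRegPrIntLS2BetaCellMaximalSquareFunction (cellMax_invariant cl_subset_of_le)

/-! ## §1 Two-kernel composition algebra (heterogeneous finite types) -/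

section Composition

variable {X Y Z : Type*} [Fintype Y]

/-- ★ Composition of nonnegative kernels is nonnegative. [folklore] -/
theorem comp_nonneg (W : X → Y → ℝ) (W' : Y → Z → ℝ) (p : X) (q : Z) (hW : ∀ z, 0 ≤ W p z) (hW' : ∀ z, 0 ≤ W' z q) :
    0 ≤ ∑ z, W p z * W' z q :=
  sum_nonneg fun z _ => mul_nonneg (hW z) (hW' z)

/-- ★ **MAX × COLSUM**: `Σ_z W p z·W′ z q ≤ (max_z W p z)·(Σ_z W′ z q) ≤ mW·cW′` — the entrywise maximum of a composed kernel is at most the maximum of the outer factor times the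
column sum of the inner factor (the letter behind `max K_n ≤ L^{(2−d)n}`). [folklore] -/
theorem comp_le_max_mul_colsum (W : X → Y → ℝ) (W' : Y → Z → ℝ) (p : X) (q : Z) {mW cW' : ℝ} (hmW : 0 ≤ mW)
    (hW : ∀ z, W p z ≤ mW) (hW' : ∀ z, 0 ≤ W' z q) (hcol : ∑ z, W' z q ≤ cW') :
    ∑ z, W p z * W' z q ≤ mW * cW' :=
  calc ∑ z, W p z * W' z q ≤ ∑ z, mW * W' z q := sum_le_sum fun z _ => mul_le_mul_of_nonneg_right (hW z) (hW' z)
    _ = mW * ∑ z, W' z q := by rw [mul_sum]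
    _ ≤ mW * cW' := mul_le_mul_of_nonneg_left hcol hmW

/-- ★ **COLSUM × COLSUM**: `Σ_p Σ_z W p z·W′ z q ≤ cW·cW′` when every column sum of `W` is `≤ cW` (`cW ≥ 0`), `W′ ≥ 0` and the `q`-column sum of `W′` is `≤ cW′`. [folklore] -/
theorem colsum_comp_le [Fintype X] (W : X → Y → ℝ) (W' : Y → Z → ℝ) (q : Z) {cW cW' : ℝ} (hcW : 0 ≤ cW)
    (hcolW : ∀ z, ∑ p, W p z ≤ cW) (hW' : ∀ z, 0 ≤ W' z q) (hcolW' : ∑ z, W' z q ≤ cW') :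
    ∑ p, ∑ z, W p z * W' z q ≤ cW * cW' :=
  calc ∑ p, ∑ z, W p z * W' z q = ∑ z, (∑ p, W p z) * W' z q := by rw [sum_comm]; simp_rw [sum_mul]
    _ ≤ ∑ z, cW * W' z q := sum_le_sum fun z _ => mul_le_mul_of_nonneg_right (hcolW z) (hW' z)
    _ = cW * ∑ z, W' z q := by rw [mul_sum]
    _ ≤ cW * cW' := mul_le_mul_of_nonneg_left hcolW' hcW

/-- ★ **ROWSUM × ROWSUM**: `Σ_q Σ_z W p z·W′ z q ≤ rW·rW′` when the `p`-row sum of `W` is `≤ rW`, `W p · ≥ 0`, and every row sum of `W′` is `≤ rW′` (`rW′ ≥ 0`) — the letter behind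
`Σ_q K_n = L^{2n}` (the smooth-type growth that the θ-sources of CURL-AVG C carry; recorded for the (M, V) profile's typist). [folklore] -/
theorem rowsum_comp_le [Fintype Z] (W : X → Y → ℝ) (W' : Y → Z → ℝ) (p : X) {rW rW' : ℝ} (hrW' : 0 ≤ rW')
    (hW : ∀ z, 0 ≤ W p z) (hrowW : ∑ z, W p z ≤ rW) (hrowW' : ∀ z, ∑ q, W' z q ≤ rW') :
    ∑ q, ∑ z, W p z * W' z q ≤ rW * rW' :=
  calc ∑ q, ∑ z, W p z * W' z q = ∑ z, W p z * ∑ q, W' z q := by rw [sum_comm]; simp_rw [mul_sum]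
    _ ≤ ∑ z, W p z * rW' := sum_le_sum fun z _ => mul_le_mul_of_nonneg_left (hrowW' z) (hW z)
    _ = (∑ z, W p z) * rW' := by rw [sum_mul]
    _ ≤ rW * rW' := mul_le_mul_of_nonneg_right hrowW hrW'

/-- ★ **SUPPORT COMPOSES THROUGH THE NEIGHBOURHOOD MAPS**: if `W p z ≠ 0 → z ∈ N p` and `W′ z q ≠ 0 → q ∈ N′ z`, then a nonzero composed entry at `(p, q)` has a witness
`z ∈ N p` with `q ∈ N′ z`. [folklore] -/
theorem comp_support (W : X → Y → ℝ) (W' : Y → Z → ℝ) (N : X → Finset Y) (N' : Y → Finset Z)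
    (hN : ∀ p z, W p z ≠ 0 → z ∈ N p) (hN' : ∀ z q, W' z q ≠ 0 → q ∈ N' z) (p : X) (q : Z)
    (h : ∑ z, W p z * W' z q ≠ 0) : ∃ z ∈ N p, q ∈ N' z := by
  obtain ⟨z, -, hz⟩ := exists_ne_zero_of_sum_ne_zero h
  exact ⟨z, hN p z (left_ne_zero_of_mul hz), hN' z q (right_ne_zero_of_mul hz)⟩

end Composition

/-! ## §2 Cell-mass domination of a bounded, cell-supported kernel -/

section Mass

variable {X : Type*} [Fintype X] [DecidableEq X]

/-- ★★ **CELL-MASS DOMINATION**: a kernel row with entries `≤ μ` (`μ ≥ 0`), supported in the gen-`n` classes of the representatives `nb`, propagates nonnegative data `ρ` to at most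
`μ·Σ_{r ∈ nb} S_n(r)` (`S_n(r) = Σ_{z ∈ cl n r} ρ z`): the TRUE kernel sees an `ℓ¹` MASS per support cell, priced by its maximal entry — dilution and sup in one letter.
[cite: Balaban1985Averaging, (19)-(20) p.21 (bookkeeping of the one-step plaquette average)] -/
theorem kernel_le_mass (cl : ℕ → X → Finset X) (n : ℕ) (Krow : X → ℝ) (nb : Finset X) {μ : ℝ} (hμ : 0 ≤ μ)
    (hKμ : ∀ q, Krow q ≤ μ) (hsupp : ∀ q, Krow q ≠ 0 → ∃ r ∈ nb, q ∈ cl n r)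
    (ρ : X → ℝ) (hρ : ∀ q, 0 ≤ ρ q) :
    ∑ q, Krow q * ρ q ≤ μ * ∑ r ∈ nb, ∑ z ∈ cl n r, ρ z := by
  -- pointwise: `Krow q ≤ Σ_{r ∈ nb} (if q ∈ cl n r then μ else 0)`
  have hpt : ∀ q, Krow q ≤ ∑ r ∈ nb, if q ∈ cl n r then μ else 0 := by
    intro q
    by_cases hq : Krow q = 0
    · rw [hq]; exact sum_nonneg fun r _ => by split_ifs <;> [exact hμ; exact le_rfl]
    · obtain ⟨r, hr, hqr⟩ := hsupp q hq
      calc Krow q ≤ μ := hKμ q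
        _ = if q ∈ cl n r then μ else 0 := by rw [if_pos hqr]
        _ ≤ ∑ r' ∈ nb, if q ∈ cl n r' then μ else 0 :=
            single_le_sum (f := fun r' => if q ∈ cl n r' then μ else 0) (fun r' _ => by split_ifs <;> [exact hμ; exact le_rfl]) hr
  calc ∑ q, Krow q * ρ q ≤ ∑ q, (∑ r ∈ nb, if q ∈ cl n r then μ else 0) * ρ q :=
        sum_le_sum fun q _ => mul_le_mul_of_nonneg_right (hpt q) (hρ q)
    _ = ∑ r ∈ nb, ∑ q, (if q ∈ cl n r then μ else 0) * ρ q := by rw [sum_comm]; simp_rw [sum_mul]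
    _ = ∑ r ∈ nb, μ * ∑ z ∈ cl n r, ρ z := by
        refine sum_congr rfl fun r _ => ?_
        rw [mul_sum, ← sum_filter_add_sum_filter_not univ (fun q => q ∈ cl n r)]
        have h1 : ∑ q ∈ univ.filter (fun q => q ∈ cl n r), (if q ∈ cl n r then μ else 0) * ρ q = ∑ z ∈ cl n r, μ * ρ z := by
          rw [filter_mem_eq_inter, univ_inter]
          exact sum_congr rfl fun q hq => by rw [if_pos hq]
        have h2 : ∑ q ∈ univ.filter (fun q => ¬ q ∈ cl n r), (if q ∈ cl n r then μ else 0) * ρ q = 0 :=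
          sum_eq_zero fun q hq => by rw [mem_filter] at hq; rw [if_neg hq.2, zero_mul]
        rw [h1, h2, add_zero]
    _ = μ * ∑ r ∈ nb, ∑ z ∈ cl n r, ρ z := by rw [mul_sum]

end Mass

/-! ## §3 The dock, cell-mass form -/

section Dock

variable {X : Type*} [Fintype X] [DecidableEq X] {ι : Type*} [Fintype ι]

/-- ★★★ **THE COMPOSED-KERNEL DOCK, CELL-MASS FORM.**  Data: (★)'s class maps `cl` (`b ≥ 4`); `ρ : X → ℝ`; top generation `m`; read sets `read n i`; propagated values `P n y` with
`0 ≤ P n y ≤ μ n·Σ_{r ∈ nb n y} S_n(r)` at every read representative (`#(nb n y) ≤ κ`); every support representative `r ∈ nb n y` of a read `y ∈ read n i` (`n ≤ m`) lies in the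
gen-`m` class of some `r₀ ∈ top i`; `top i ⊆ R`, the gen-`m` classes of `R` pairwise disjoint, each `r ∈ R` in `top i` for at most `ν` indices `i`; weights `Λ n ≥ 0` with the
FLATNESS `Λ n·(μ n)²·b^n ≤ Λ★` for `n ≤ m`.  Then for EVERY selection `sel n i ∈ read n i`:
    `Σ_{n ≤ m} Λ n·Σ_i P n (sel n i)² ≤ Λ★·κ²·ν·(2(b−1)∕(b−3))·Σ_z ρ z²`.
Proof: Chebyshev over the `κ` support cells; `S_n(r)² = b^n·(S_n(r)²∕b^n)` and each support cell's `S_n(r)²∕b^n` is below the best gen-`n` value inside its top class; flatness;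
swap `Σ_n` inside; (★) `cellMax_invariant` per top class; multiplicity `ν` and disjointness of `R`.  The constant does NOT see `m`.
[cite: Balaban1985Averaging, Prop. 4 (128)-(135) pp.37-38 (the printed sup recursion this bookkeeping serves); Balaban1987RG1, (0.11) p.253] -/
theorem dock_of_cellMass (b : ℕ) (hb : 4 ≤ b) (cl : ℕ → X → Finset X) (h_mem : ∀ n x, x ∈ cl n x)
    (h_eq : ∀ n x y, y ∈ cl n x → cl n y = cl n x) (h_nest : ∀ n x, cl n x ⊆ cl (n + 1) x) (h_card : ∀ n x, (cl n x).card ≤ b ^ n)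
    (ρ : X → ℝ) (m : ℕ) (read : ℕ → ι → Finset X) (P : ℕ → X → ℝ) (μ : ℕ → ℝ) (nb : ℕ → X → Finset X) (κ : ℕ)
    (hnb : ∀ n y, (nb n y).card ≤ κ)
    (hP0 : ∀ n ≤ m, ∀ i, ∀ y ∈ read n i, 0 ≤ P n y)
    (hP : ∀ n ≤ m, ∀ i, ∀ y ∈ read n i, P n y ≤ μ n * ∑ r ∈ nb n y, ∑ z ∈ cl n r, ρ z)
    (top : ι → Finset X) (R : Finset X) (ν : ℕ)
    (hread : ∀ n ≤ m, ∀ i, ∀ y ∈ read n i, ∀ r ∈ nb n y, ∃ r₀ ∈ top i, r ∈ cl m r₀)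
    (htop : ∀ i, top i ⊆ R) (hR : (R : Set X).PairwiseDisjoint (fun r => cl m r))
    (hν : ∀ r ∈ R, (univ.filter (fun i => r ∈ top i)).card ≤ ν)
    (Λ : ℕ → ℝ) (Λstar : ℝ) (hΛ : ∀ n, 0 ≤ Λ n) (hflat : ∀ n ≤ m, Λ n * μ n ^ 2 * (b : ℝ) ^ n ≤ Λstar)
    (sel : ℕ → ι → X) (hsel : ∀ n ≤ m, ∀ i, sel n i ∈ read n i) :
    ∑ n ∈ range (m + 1), Λ n * ∑ i, P n (sel n i) ^ 2 ≤
      Λstar * (κ : ℝ) ^ 2 * ν * (2 * ((b : ℝ) - 1) / ((b : ℝ) - 3)) * ∑ z, ρ z ^ 2 := by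
  have hb' : (4 : ℝ) ≤ b := by exact_mod_cast hb
  have hbpos : 0 < (b : ℝ) := by linarith
  have hC0 : 0 ≤ 2 * ((b : ℝ) - 1) / ((b : ℝ) - 3) := by apply div_nonneg <;> nlinarith
  -- abbreviations (as local functions, no `def`)
  -- `Mx n r₀` := the best gen-`n` value `S_n(y')²∕b^n` inside the top class of `r₀`
  set Mx : ℕ → X → ℝ := fun n r₀ => (cl m r₀).sup' ⟨r₀, h_mem m r₀⟩ (fun y' => (∑ z ∈ cl n y', ρ z) ^ 2 / (b : ℝ) ^ n) with hMx
  have hMx0 : ∀ n r₀, 0 ≤ Mx n r₀ := fun n r₀ =>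
    le_sup'_of_le (fun y' => (∑ z ∈ cl n y', ρ z) ^ 2 / (b : ℝ) ^ n) (h_mem m r₀)
      (show (0 : ℝ) ≤ (∑ z ∈ cl n r₀, ρ z) ^ 2 / (b : ℝ) ^ n by positivity)
  -- Λ★ is nonnegative as soon as `m ≥ 0` is inhabited: from `hflat 0`
  have hΛstar : 0 ≤ Λstar :=
    (mul_nonneg (mul_nonneg (hΛ 0) (sq_nonneg _)) (pow_nonneg hbpos.le _)).trans (hflat 0 (Nat.zero_le m))
  -- STEP A: per generation `n ≤ m` and bond `i`, `Λ n · P n (sel n i)² ≤ Λ★·κ²·Σ_{r₀ ∈ top i} Mx n r₀`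
  have hA : ∀ n ∈ range (m + 1), ∀ i, Λ n * P n (sel n i) ^ 2 ≤ Λstar * (κ : ℝ) ^ 2 * ∑ r₀ ∈ top i, Mx n r₀ := by
    intro n hn i
    have hnm : n ≤ m := by rw [mem_range] at hn; omega
    set y := sel n i with hy
    have hyr : y ∈ read n i := hsel n hnm i
    have hP0' := hP0 n hnm i y hyr
    have hP' := hP n hnm i y hyr
    have hbn : 0 < (b : ℝ) ^ n := pow_pos hbpos n
    -- Chebyshev over the support cells
    have hcheb : (∑ r ∈ nb n y, ∑ z ∈ cl n r, ρ z) ^ 2 ≤ κ * ∑ r ∈ nb n y, (∑ z ∈ cl n r, ρ z) ^ 2 := by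
      have h := sq_sum_le_card_mul_sum_sq (s := nb n y) (f := fun r => ∑ z ∈ cl n r, ρ z)
      refine h.trans (mul_le_mul_of_nonneg_right ?_ (sum_nonneg fun r _ => sq_nonneg _))
      exact_mod_cast hnb n y
    -- each support cell's value is below the best value in its top class, summed over `top i`
    have hcell : ∀ r ∈ nb n y, (∑ z ∈ cl n r, ρ z) ^ 2 / (b : ℝ) ^ n ≤ ∑ r₀ ∈ top i, Mx n r₀ := by
      intro r hr
      obtain ⟨r₀, hr₀, hrr₀⟩ := hread n hnm i y hyr r hr
      calc (∑ z ∈ cl n r, ρ z) ^ 2 / (b : ℝ) ^ n ≤ Mx n r₀ := le_sup' (fun y' => (∑ z ∈ cl n y', ρ z) ^ 2 / (b : ℝ) ^ n) hrr₀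
        _ ≤ ∑ r₀' ∈ top i, Mx n r₀' := single_le_sum (f := fun r₀' => Mx n r₀') (fun r₀' _ => hMx0 n r₀') hr₀
    have hsumcell : ∑ r ∈ nb n y, (∑ z ∈ cl n r, ρ z) ^ 2 ≤ (b : ℝ) ^ n * (κ * ∑ r₀ ∈ top i, Mx n r₀) := by
      have h1 : ∀ r ∈ nb n y, (∑ z ∈ cl n r, ρ z) ^ 2 ≤ (b : ℝ) ^ n * ∑ r₀ ∈ top i, Mx n r₀ := by
        intro r hr
        have := hcell r hr
        rwa [div_le_iff₀ hbn, mul_comm] at this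
      calc ∑ r ∈ nb n y, (∑ z ∈ cl n r, ρ z) ^ 2 ≤ ∑ r ∈ nb n y, (b : ℝ) ^ n * ∑ r₀ ∈ top i, Mx n r₀ := sum_le_sum h1
        _ = (nb n y).card * ((b : ℝ) ^ n * ∑ r₀ ∈ top i, Mx n r₀) := by rw [sum_const, nsmul_eq_mul]
        _ ≤ κ * ((b : ℝ) ^ n * ∑ r₀ ∈ top i, Mx n r₀) := by
            refine mul_le_mul_of_nonneg_right (by exact_mod_cast hnb n y) ?_
            exact mul_nonneg hbn.le (sum_nonneg fun r₀ _ => hMx0 n r₀)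
        _ = (b : ℝ) ^ n * (κ * ∑ r₀ ∈ top i, Mx n r₀) := by ring
    -- assemble: P² ≤ μ²·κ·Σ S² ≤ μ²·κ·b^n·κ·Σ Mx, then flatness
    have hSMx : 0 ≤ ∑ r₀ ∈ top i, Mx n r₀ := sum_nonneg fun r₀ _ => hMx0 n r₀
    have hPsq : P n y ^ 2 ≤ μ n ^ 2 * ((κ : ℝ) ^ 2 * (b : ℝ) ^ n * ∑ r₀ ∈ top i, Mx n r₀) := by
      have h1 : P n y ^ 2 ≤ (μ n * ∑ r ∈ nb n y, ∑ z ∈ cl n r, ρ z) ^ 2 := pow_le_pow_left₀ hP0' hP' 2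
      have hκ : (0 : ℝ) ≤ κ := Nat.cast_nonneg κ
      calc P n y ^ 2 ≤ μ n ^ 2 * (∑ r ∈ nb n y, ∑ z ∈ cl n r, ρ z) ^ 2 := by rw [mul_pow] at h1; exact h1
        _ ≤ μ n ^ 2 * (κ * ∑ r ∈ nb n y, (∑ z ∈ cl n r, ρ z) ^ 2) := mul_le_mul_of_nonneg_left hcheb (sq_nonneg _)
        _ ≤ μ n ^ 2 * (κ * ((b : ℝ) ^ n * (κ * ∑ r₀ ∈ top i, Mx n r₀))) :=
            mul_le_mul_of_nonneg_left (mul_le_mul_of_nonneg_left hsumcell hκ) (sq_nonneg _)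
        _ = μ n ^ 2 * ((κ : ℝ) ^ 2 * (b : ℝ) ^ n * ∑ r₀ ∈ top i, Mx n r₀) := by ring
    calc Λ n * P n y ^ 2 ≤ Λ n * (μ n ^ 2 * ((κ : ℝ) ^ 2 * (b : ℝ) ^ n * ∑ r₀ ∈ top i, Mx n r₀)) := mul_le_mul_of_nonneg_left hPsq (hΛ n)
      _ = (Λ n * μ n ^ 2 * (b : ℝ) ^ n) * ((κ : ℝ) ^ 2 * ∑ r₀ ∈ top i, Mx n r₀) := by ring
      _ ≤ Λstar * ((κ : ℝ) ^ 2 * ∑ r₀ ∈ top i, Mx n r₀) := mul_le_mul_of_nonneg_right (hflat n hnm) (mul_nonneg (sq_nonneg _) hSMx)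
      _ = Λstar * (κ : ℝ) ^ 2 * ∑ r₀ ∈ top i, Mx n r₀ := by ring
  -- STEP B: sum over `n` and `i`, swap, and apply (★) per top class
  have hB : ∑ n ∈ range (m + 1), Λ n * ∑ i, P n (sel n i) ^ 2 ≤
      Λstar * (κ : ℝ) ^ 2 * ∑ i, ∑ r₀ ∈ top i, ∑ n ∈ range (m + 1), Mx n r₀ := by
    calc ∑ n ∈ range (m + 1), Λ n * ∑ i, P n (sel n i) ^ 2 = ∑ n ∈ range (m + 1), ∑ i, Λ n * P n (sel n i) ^ 2 := by simp_rw [mul_sum]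
      _ ≤ ∑ n ∈ range (m + 1), ∑ i, Λstar * (κ : ℝ) ^ 2 * ∑ r₀ ∈ top i, Mx n r₀ := sum_le_sum fun n hn => sum_le_sum fun i _ => hA n hn i
      _ = Λstar * (κ : ℝ) ^ 2 * ∑ n ∈ range (m + 1), ∑ i, ∑ r₀ ∈ top i, Mx n r₀ := by simp_rw [mul_sum]
      _ = Λstar * (κ : ℝ) ^ 2 * ∑ i, ∑ r₀ ∈ top i, ∑ n ∈ range (m + 1), Mx n r₀ := by
          congr 1; rw [sum_comm]; exact sum_congr rfl fun i _ => sum_comm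
  -- (★) per top class: `Σ_n Mx n r₀ ≤ C_b · E(cl m r₀)`
  have hstar : ∀ r₀, ∑ n ∈ range (m + 1), Mx n r₀ ≤ (2 * ((b : ℝ) - 1) / ((b : ℝ) - 3)) * ∑ z ∈ cl m r₀, ρ z ^ 2 := by
    intro r₀
    have hinv := cellMax_invariant b hb cl h_mem h_eq h_nest h_card ρ m r₀
    have hD : 0 ≤ (2 / ((b : ℝ) - 3)) * ((∑ z ∈ cl m r₀, ρ z) ^ 2 / (b : ℝ) ^ m) := by
      apply mul_nonneg
      · apply div_nonneg <;> linarith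
      · positivity
    have : ∑ n ∈ range (m + 1), Mx n r₀ = ∑ j ∈ range (m + 1), (cl m r₀).sup' ⟨r₀, h_mem m r₀⟩ (fun y' => (∑ z ∈ cl j y', ρ z) ^ 2 / (b : ℝ) ^ j) := rfl
    linarith
  -- STEP C: multiplicity `ν` and disjointness of `R`
  have hE0 : ∀ r₀, 0 ≤ ∑ z ∈ cl m r₀, ρ z ^ 2 := fun r₀ => sum_nonneg fun z _ => sq_nonneg _
  have hC : ∑ i, ∑ r₀ ∈ top i, ∑ z ∈ cl m r₀, ρ z ^ 2 ≤ ν * ∑ z, ρ z ^ 2 := by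
    -- rewrite the inner sum over `top i ⊆ R` as a filtered sum over `R`, swap, count
    have h1 : ∀ i, ∑ r₀ ∈ top i, ∑ z ∈ cl m r₀, ρ z ^ 2 = ∑ r₀ ∈ R, if r₀ ∈ top i then ∑ z ∈ cl m r₀, ρ z ^ 2 else 0 := by
      intro i
      rw [← sum_filter, filter_mem_eq_inter, inter_eq_right.mpr (htop i)]
    have h2 : ∑ i, ∑ r₀ ∈ R, (if r₀ ∈ top i then ∑ z ∈ cl m r₀, ρ z ^ 2 else 0) =
        ∑ r₀ ∈ R, ((univ.filter (fun i => r₀ ∈ top i)).card : ℝ) * ∑ z ∈ cl m r₀, ρ z ^ 2 := by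
      rw [sum_comm]
      refine sum_congr rfl fun r₀ _ => ?_
      rw [← sum_filter, sum_const, nsmul_eq_mul]
    have h3 : ∑ r₀ ∈ R, ((univ.filter (fun i => r₀ ∈ top i)).card : ℝ) * ∑ z ∈ cl m r₀, ρ z ^ 2 ≤ ∑ r₀ ∈ R, (ν : ℝ) * ∑ z ∈ cl m r₀, ρ z ^ 2 :=
      sum_le_sum fun r₀ hr₀ => mul_le_mul_of_nonneg_right (by exact_mod_cast hν r₀ hr₀) (hE0 r₀)
    have h4 : ∑ r₀ ∈ R, ∑ z ∈ cl m r₀, ρ z ^ 2 ≤ ∑ z, ρ z ^ 2 := by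
      rw [← sum_biUnion hR]
      exact sum_le_sum_of_subset_of_nonneg (subset_univ _) fun z _ _ => sq_nonneg _
    calc ∑ i, ∑ r₀ ∈ top i, ∑ z ∈ cl m r₀, ρ z ^ 2 = ∑ i, ∑ r₀ ∈ R, (if r₀ ∈ top i then ∑ z ∈ cl m r₀, ρ z ^ 2 else 0) := sum_congr rfl fun i _ => h1 i
      _ = ∑ r₀ ∈ R, ((univ.filter (fun i => r₀ ∈ top i)).card : ℝ) * ∑ z ∈ cl m r₀, ρ z ^ 2 := h2
      _ ≤ ∑ r₀ ∈ R, (ν : ℝ) * ∑ z ∈ cl m r₀, ρ z ^ 2 := h3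
      _ = ν * ∑ r₀ ∈ R, ∑ z ∈ cl m r₀, ρ z ^ 2 := by rw [mul_sum]
      _ ≤ ν * ∑ z, ρ z ^ 2 := mul_le_mul_of_nonneg_left h4 (Nat.cast_nonneg ν)
  -- conclude
  have hD : ∑ i, ∑ r₀ ∈ top i, ∑ n ∈ range (m + 1), Mx n r₀ ≤ (2 * ((b : ℝ) - 1) / ((b : ℝ) - 3)) * (ν * ∑ z, ρ z ^ 2) := by
    calc ∑ i, ∑ r₀ ∈ top i, ∑ n ∈ range (m + 1), Mx n r₀ ≤ ∑ i, ∑ r₀ ∈ top i, (2 * ((b : ℝ) - 1) / ((b : ℝ) - 3)) * ∑ z ∈ cl m r₀, ρ z ^ 2 :=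
          sum_le_sum fun i _ => sum_le_sum fun r₀ _ => hstar r₀
      _ = (2 * ((b : ℝ) - 1) / ((b : ℝ) - 3)) * ∑ i, ∑ r₀ ∈ top i, ∑ z ∈ cl m r₀, ρ z ^ 2 := by simp_rw [mul_sum]
      _ ≤ (2 * ((b : ℝ) - 1) / ((b : ℝ) - 3)) * (ν * ∑ z, ρ z ^ 2) := mul_le_mul_of_nonneg_left hC hC0
  calc ∑ n ∈ range (m + 1), Λ n * ∑ i, P n (sel n i) ^ 2 ≤ Λstar * (κ : ℝ) ^ 2 * ∑ i, ∑ r₀ ∈ top i, ∑ n ∈ range (m + 1), Mx n r₀ := hB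
    _ ≤ Λstar * (κ : ℝ) ^ 2 * ((2 * ((b : ℝ) - 1) / ((b : ℝ) - 3)) * (ν * ∑ z, ρ z ^ 2)) :=
        mul_le_mul_of_nonneg_left hD (mul_nonneg hΛstar (sq_nonneg _))
    _ = Λstar * (κ : ℝ) ^ 2 * ν * (2 * ((b : ℝ) - 1) / ((b : ℝ) - 3)) * ∑ z, ρ z ^ 2 := by ring

/-- ★★ **THE DOCK, CELL-MASS FORM, `sup'` EDITION**: for nonempty read sets the weighted sum of the read-set MAXIMA obeys the same bound (pick the maximising selection).
[cite: Balaban1985Averaging, Prop. 4 (128)-(135) pp.37-38] -/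
theorem dock_of_cellMass_sup' (b : ℕ) (hb : 4 ≤ b) (cl : ℕ → X → Finset X) (h_mem : ∀ n x, x ∈ cl n x)
    (h_eq : ∀ n x y, y ∈ cl n x → cl n y = cl n x) (h_nest : ∀ n x, cl n x ⊆ cl (n + 1) x) (h_card : ∀ n x, (cl n x).card ≤ b ^ n)
    (ρ : X → ℝ) (m : ℕ) (read : ℕ → ι → Finset X) (hne : ∀ n i, (read n i).Nonempty) (P : ℕ → X → ℝ) (μ : ℕ → ℝ) (nb : ℕ → X → Finset X) (κ : ℕ)
    (hnb : ∀ n y, (nb n y).card ≤ κ)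
    (hP0 : ∀ n ≤ m, ∀ i, ∀ y ∈ read n i, 0 ≤ P n y)
    (hP : ∀ n ≤ m, ∀ i, ∀ y ∈ read n i, P n y ≤ μ n * ∑ r ∈ nb n y, ∑ z ∈ cl n r, ρ z)
    (top : ι → Finset X) (R : Finset X) (ν : ℕ)
    (hread : ∀ n ≤ m, ∀ i, ∀ y ∈ read n i, ∀ r ∈ nb n y, ∃ r₀ ∈ top i, r ∈ cl m r₀)
    (htop : ∀ i, top i ⊆ R) (hR : (R : Set X).PairwiseDisjoint (fun r => cl m r))
    (hν : ∀ r ∈ R, (univ.filter (fun i => r ∈ top i)).card ≤ ν)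
    (Λ : ℕ → ℝ) (Λstar : ℝ) (hΛ : ∀ n, 0 ≤ Λ n) (hflat : ∀ n ≤ m, Λ n * μ n ^ 2 * (b : ℝ) ^ n ≤ Λstar) :
    ∑ n ∈ range (m + 1), Λ n * ∑ i, (read n i).sup' (hne n i) (fun y => P n y ^ 2) ≤
      Λstar * (κ : ℝ) ^ 2 * ν * (2 * ((b : ℝ) - 1) / ((b : ℝ) - 3)) * ∑ z, ρ z ^ 2 := by
  -- the maximising selection
  have hex : ∀ n i, ∃ y ∈ read n i, (read n i).sup' (hne n i) (fun y => P n y ^ 2) = P n y ^ 2 :=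
    fun n i => exists_mem_eq_sup' (hne n i) (fun y => P n y ^ 2)
  choose sel hsel hseleq using hex
  have h := dock_of_cellMass b hb cl h_mem h_eq h_nest h_card ρ m read P μ nb κ hnb hP0 hP top R ν hread htop hR hν Λ Λstar hΛ hflat
    sel (fun n _ i => hsel n i)
  calc ∑ n ∈ range (m + 1), Λ n * ∑ i, (read n i).sup' (hne n i) (fun y => P n y ^ 2)
      = ∑ n ∈ range (m + 1), Λ n * ∑ i, P n (sel n i) ^ 2 := by simp_rw [hseleq]
    _ ≤ _ := h

end Dock

/-! ## §4 The dock, kernel form -/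

section Kernel

variable {X : Type*} [Fintype X] [DecidableEq X] {ι : Type*} [Fintype ι]

/-- ★★★ **THE COMPOSED-KERNEL DOCK, KERNEL FORM** — the K-UNIFORM curl-driven part of (SCT′-c)₁: with composed kernels `K n` (`0 ≤ K n y q ≤ μ n`, support in the gen-`n` classes
of `≤ κ` representatives `nb n y`), read sets whose support representatives sit in the top classes of `top i ⊆ R` (pairwise-disjoint gen-`m` classes, multiplicity `≤ ν`),
nonnegative finest data `ρ`, and FLAT weights `Λ n·(μ n)²·b^n ≤ Λ★` (at `d = 3`: `L^{k−1−n}·L^{−2n}·L^{3n} = L^{k−1}`), for EVERY selection `sel n i ∈ read n i`: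
    `Σ_{n ≤ m} Λ n·Σ_i (Σ_q K n (sel n i) q·ρ q)² ≤ Λ★·κ²·ν·(2(b−1)∕(b−3))·Σ_q ρ q²`.
[cite: Balaban1985Averaging, Prop. 4 (128)-(135) pp.37-38; Balaban1987RG1, (0.11) p.253] -/
theorem dock_of_kernel (b : ℕ) (hb : 4 ≤ b) (cl : ℕ → X → Finset X) (h_mem : ∀ n x, x ∈ cl n x)
    (h_eq : ∀ n x y, y ∈ cl n x → cl n y = cl n x) (h_nest : ∀ n x, cl n x ⊆ cl (n + 1) x) (h_card : ∀ n x, (cl n x).card ≤ b ^ n)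
    (ρ : X → ℝ) (hρ : ∀ q, 0 ≤ ρ q) (m : ℕ) (read : ℕ → ι → Finset X) (K : ℕ → X → X → ℝ) (μ : ℕ → ℝ) (nb : ℕ → X → Finset X) (κ : ℕ)
    (hμ : ∀ n, 0 ≤ μ n) (hnb : ∀ n y, (nb n y).card ≤ κ)
    (hK0 : ∀ n y q, 0 ≤ K n y q) (hKμ : ∀ n y q, K n y q ≤ μ n) (hsupp : ∀ n y q, K n y q ≠ 0 → ∃ r ∈ nb n y, q ∈ cl n r)
    (top : ι → Finset X) (R : Finset X) (ν : ℕ)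
    (hread : ∀ n ≤ m, ∀ i, ∀ y ∈ read n i, ∀ r ∈ nb n y, ∃ r₀ ∈ top i, r ∈ cl m r₀)
    (htop : ∀ i, top i ⊆ R) (hR : (R : Set X).PairwiseDisjoint (fun r => cl m r))
    (hν : ∀ r ∈ R, (univ.filter (fun i => r ∈ top i)).card ≤ ν)
    (Λ : ℕ → ℝ) (Λstar : ℝ) (hΛ : ∀ n, 0 ≤ Λ n) (hflat : ∀ n ≤ m, Λ n * μ n ^ 2 * (b : ℝ) ^ n ≤ Λstar)
    (sel : ℕ → ι → X) (hsel : ∀ n ≤ m, ∀ i, sel n i ∈ read n i) :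
    ∑ n ∈ range (m + 1), Λ n * ∑ i, (∑ q, K n (sel n i) q * ρ q) ^ 2 ≤
      Λstar * (κ : ℝ) ^ 2 * ν * (2 * ((b : ℝ) - 1) / ((b : ℝ) - 3)) * ∑ z, ρ z ^ 2 :=
  dock_of_cellMass b hb cl h_mem h_eq h_nest h_card ρ m read (fun n y => ∑ q, K n y q * ρ q) μ nb κ hnb
    (fun n _ _ y _ => sum_nonneg fun q _ => mul_nonneg (hK0 n y q) (hρ q))
    (fun n _ _ y _ => kernel_le_mass cl n (K n y) (nb n y) (hμ n) (hKμ n y) (hsupp n y) ρ hρ)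
    top R ν hread htop hR hν Λ Λstar hΛ hflat sel hsel

/-- ★★ **KERNEL FORM, `sup'` EDITION** (nonempty read sets; the read-set maxima). [cite: Balaban1985Averaging, Prop. 4 (128)-(135) pp.37-38] -/
theorem dock_of_kernel_sup' (b : ℕ) (hb : 4 ≤ b) (cl : ℕ → X → Finset X) (h_mem : ∀ n x, x ∈ cl n x)
    (h_eq : ∀ n x y, y ∈ cl n x → cl n y = cl n x) (h_nest : ∀ n x, cl n x ⊆ cl (n + 1) x) (h_card : ∀ n x, (cl n x).card ≤ b ^ n)
    (ρ : X → ℝ) (hρ : ∀ q, 0 ≤ ρ q) (m : ℕ) (read : ℕ → ι → Finset X) (hne : ∀ n i, (read n i).Nonempty) (K : ℕ → X → X → ℝ) (μ : ℕ → ℝ)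
    (nb : ℕ → X → Finset X) (κ : ℕ) (hμ : ∀ n, 0 ≤ μ n) (hnb : ∀ n y, (nb n y).card ≤ κ)
    (hK0 : ∀ n y q, 0 ≤ K n y q) (hKμ : ∀ n y q, K n y q ≤ μ n) (hsupp : ∀ n y q, K n y q ≠ 0 → ∃ r ∈ nb n y, q ∈ cl n r)
    (top : ι → Finset X) (R : Finset X) (ν : ℕ)
    (hread : ∀ n ≤ m, ∀ i, ∀ y ∈ read n i, ∀ r ∈ nb n y, ∃ r₀ ∈ top i, r ∈ cl m r₀)
    (htop : ∀ i, top i ⊆ R) (hR : (R : Set X).PairwiseDisjoint (fun r => cl m r))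
    (hν : ∀ r ∈ R, (univ.filter (fun i => r ∈ top i)).card ≤ ν)
    (Λ : ℕ → ℝ) (Λstar : ℝ) (hΛ : ∀ n, 0 ≤ Λ n) (hflat : ∀ n ≤ m, Λ n * μ n ^ 2 * (b : ℝ) ^ n ≤ Λstar) :
    ∑ n ∈ range (m + 1), Λ n * ∑ i, (read n i).sup' (hne n i) (fun y => (∑ q, K n y q * ρ q) ^ 2) ≤
      Λstar * (κ : ℝ) ^ 2 * ν * (2 * ((b : ℝ) - 1) / ((b : ℝ) - 3)) * ∑ z, ρ z ^ 2 :=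
  dock_of_cellMass_sup' b hb cl h_mem h_eq h_nest h_card ρ m read hne (fun n y => ∑ q, K n y q * ρ q) μ nb κ hnb
    (fun n _ _ y _ => sum_nonneg fun q _ => mul_nonneg (hK0 n y q) (hρ q))
    (fun n _ _ y _ => kernel_le_mass cl n (K n y) (nb n y) (hμ n) (hKμ n y) (hsupp n y) ρ hρ)
    top R ν hread htop hR hν Λ Λstar hΛ hflat

end Kernel

end Summit.QuantumFields.YangMills.Theorems.FluctuationComparisonRegPrIntLS2BetaComposedKernelDock
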